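import Mathlib.Algebra.Group.Basic
import Mathlib.Algebra.Module.Defs
import Mathlib.Data.ZMod.Basic
import Mathlib.Data.Fintype.Prod
import Mathlib.Tactic.Abel
import Mathlib.Tactic.NormNum
import Mathlib.Tactic.DeriveFintype
import HarnessLib

/-!
# Prym–Torelli for the Klein data at `f = 24`: the admissible torsor — kernel skeleton (WEIL-2 gen 46, KLEIN-G46, fact-free)

research route, not a corollary; conditional on HC_CM plus one named minimal statement.

Cell `pub-hodge-ring2-ab-*` (ALL ABELIAN VARIETIES), seat WEIL-2 gen 46, account
`run/shared/lean/pub/pub-hodge-ring2/pub-hodge-ring2-ab-weil-2/KLEIN-G46.md`.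

Informal setting (TRANSFER-G45 §4, KLEIN-G46 §1).  `G = ℤ/24 ⋊ H`, `H = ker χ_{ℚ(√−6)} = {1, 5, 7, 11} ≅ C₂ × C₂`, acting on
`ℤ/24` by multiplication; the three open Castelnuovo-boundary data of TRANSFER-G45 §4 are `C₂ × C₂`-covers `C' → ℙ¹` with
`s = 1`, `B' = w + w'` the fibre over the `(2,1)`-point (residues `8, 16`).  KLEIN-G46 LEMMA A describes the admissible classes
`D₀ = 3e₈ − D₃ + w + w'`: `e₈ = ψ(a, c)` in the Prym `P = (E_σ × E_{στ})/K` of `C' → C'/τ` with `(4a, 6c) ∈ K`, `(8a, 8c) ∈ K`,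
and the dichotomy «disconnected (`4a = 0`, `2c = 0`) or `4a = κ`, `4c = 0`, `2c = κ'`» (`glued_torsion_dichotomy` below, for an
arbitrary pair of additive commutative groups); the bookkeeping between admissible classes and `G`-covers uses
`H¹(H; ℤ/24) ≅ ℤ/2` (`crossedHom_card`, `coboundary_card`, `coboundary_subset_crossedHom`), the splitting of the lifts of
`α₅, α₇, α₁₁` (`lift_obstruction_five/seven/eleven`), the classes of involutions over `α₇` and the residues at the `(2,1)`-point
(`involutions_over_seven`, `order_six_over_seven_residues`), the centre of `G` (`centre_of_G`), and the model counts of the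
torsion conditions (`model_count_a`, `model_count_c`, `model_count_n`) together with the cover counts (`cover_count_arithmetic`).

0 sorry, no `def`, no named fact; `HC_CM` does not occur.
-/

namespace Summit.HodgeConjecture.Ring2AbelianAll.PrymTorelliKlein

section torsor

variable {A B : Type*} [AddCommGroup A] [AddCommGroup B]

/-- KLEIN-G46 LEMMA A (core dichotomy).  In the Prym `P = (E_σ × E_{στ})/K`, `K = {0, (κ, κ')}` with `2κ = 0`, `2κ' = 0`,
`κ ≠ 0`, a pair `(a, c)` represents an admissible `e₈` iff `(4a, 6c) ∈ K` (the condition `σ e₈ = 5 e₈`) and `(8a, 8c) ∈ K`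
(`8 e₈ = 0`).  Then either `4a = 0 ∧ 2c = 0` (and `4e₈ = 0`: the cover is disconnected) or `4a = κ ∧ 4c = 0 ∧ 2c = κ'`.
Stated for arbitrary additive commutative groups `A ∋ a, κ` and `B ∋ c, κ'`.  [KLEIN-G46 §1.3]
research route, not a corollary; conditional on HC_CM plus one named minimal statement. -/
theorem glued_torsion_dichotomy (κ : A) (κ' : B) (hκ : (2 : ℕ) • κ = 0) (hκ' : (2 : ℕ) • κ' = 0) (hκ0 : κ ≠ 0)
    (a : A) (c : B)
    (h1 : ((4 : ℕ) • a = 0 ∧ (6 : ℕ) • c = 0) ∨ ((4 : ℕ) • a = κ ∧ (6 : ℕ) • c = κ'))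
    (h2 : ((8 : ℕ) • a = 0 ∧ (8 : ℕ) • c = 0) ∨ ((8 : ℕ) • a = κ ∧ (8 : ℕ) • c = κ')) :
    ((4 : ℕ) • a = 0 ∧ (2 : ℕ) • c = 0) ∨ ((4 : ℕ) • a = κ ∧ (4 : ℕ) • c = 0 ∧ (2 : ℕ) • c = κ') := by
  have h8a : (8 : ℕ) • a = (2 : ℕ) • ((4 : ℕ) • a) := by rw [← mul_nsmul]
  rcases h1 with ⟨h4a, h6c⟩ | ⟨h4a, h6c⟩
  · -- 4a = 0 : then 8a = 0, so the second alternative of h2 is impossible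
    have h8a0 : (8 : ℕ) • a = 0 := by rw [h8a, h4a, nsmul_zero]
    rcases h2 with ⟨_, h8c⟩ | ⟨h8aκ, _⟩
    · left
      refine ⟨h4a, ?_⟩
      have : (2 : ℕ) • c = (8 : ℕ) • c - (6 : ℕ) • c := by abel
      rw [this, h8c, h6c, sub_zero]
    · exact absurd (h8a0.symm.trans h8aκ).symm hκ0
  · -- 4a = κ : then 8a = 2κ = 0, so again 8c = 0; with 6c = κ' we get 12c = 0, 4c = 0, 2c = κ'
    have h8a0 : (8 : ℕ) • a = 0 := by rw [h8a, h4a, hκ]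
    rcases h2 with ⟨_, h8c⟩ | ⟨h8aκ, _⟩
    · right
      have h12c : (12 : ℕ) • c = 0 := by
        have : (12 : ℕ) • c = (2 : ℕ) • ((6 : ℕ) • c) := by rw [← mul_nsmul]
        rw [this, h6c, hκ']
      have h4c : (4 : ℕ) • c = 0 := by
        have : (4 : ℕ) • c = (12 : ℕ) • c - (8 : ℕ) • c := by abel
        rw [this, h12c, h8c, sub_zero]
      refine ⟨h4a, h4c, ?_⟩
      have : (2 : ℕ) • c = (6 : ℕ) • c - (4 : ℕ) • c := by abel
      rw [this, h6c, h4c, sub_zero]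
    · exact absurd (h8a0.symm.trans h8aκ).symm hκ0

/-- KLEIN-G46 LEMMA A (converse bookkeeping): if `4a = κ`, `4c = 0`, `2c = κ'` with `2κ = 0`, then `(4a, 6c) = (κ, κ')`,
`(8a, 8c) = (0, 0)` — the pair is admissible — and `4a ≠ 0` when `κ ≠ 0` (the cover is connected).  [KLEIN-G46 §1.3]
research route, not a corollary; conditional on HC_CM plus one named minimal statement. -/
theorem glued_torsion_admissible (κ : A) (κ' : B) (hκ : (2 : ℕ) • κ = 0) (hκ0 : κ ≠ 0) (a : A) (c : B)
    (h4a : (4 : ℕ) • a = κ) (h4c : (4 : ℕ) • c = 0) (h2c : (2 : ℕ) • c = κ') :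
    (6 : ℕ) • c = κ' ∧ (8 : ℕ) • a = 0 ∧ (8 : ℕ) • c = 0 ∧ (4 : ℕ) • a ≠ 0 := by
  refine ⟨?_, ?_, ?_, ?_⟩
  · have : (6 : ℕ) • c = (4 : ℕ) • c + (2 : ℕ) • c := by abel
    rw [this, h4c, h2c, zero_add]
  · have : (8 : ℕ) • a = (2 : ℕ) • ((4 : ℕ) • a) := by rw [← mul_nsmul]
    rw [this, h4a, hκ]
  · have : (8 : ℕ) • c = (2 : ℕ) • ((4 : ℕ) • c) := by rw [← mul_nsmul]
    rw [this, h4c, nsmul_zero]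
  · rw [h4a]; exact hκ0

/-- KLEIN-G46 LEMMA A (the `3`-part): `D₃ = 8D₀ − 2w − 5w'` and `e₈ = 3D₀ − w − 2w'` recover `D₀ = 3e₈ − D₃ + w + w'`;
the underlying identity `3·3 − 8 = 1` with the divisor bookkeeping, in any additive commutative group (`D₀, w, w'` arbitrary).
[KLEIN-G46 §1.2]
research route, not a corollary; conditional on HC_CM plus one named minimal statement. -/
theorem bezout_decomposition (D₀ w w' : A) :
    (3 : ℤ) • ((3 : ℤ) • D₀ - w - (2 : ℤ) • w') - ((8 : ℤ) • D₀ - (2 : ℤ) • w - (5 : ℤ) • w') + w + w' = D₀ := by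
  abel

/-- KLEIN-G46 LEMMA A (the class conditions from the pieces): with `e₈ = 3D₀ − w − 2w'` and `D₃ = 8D₀ − 2w − 5w'`,
`24 D₀ − (8w + 16w') = 9·(8 e₈) − 8·(3 D₃ − 2w − w')` — so `8e₈ ∼ 0` and `3D₃ ∼ 2w + w'` give (E1) `24D₀ ∼ δ`.  [KLEIN-G46 §1.2]
research route, not a corollary; conditional on HC_CM plus one named minimal statement. -/
theorem class_condition_E1 (D₀ w w' : A) :
    (24 : ℤ) • D₀ - ((8 : ℤ) • w + (16 : ℤ) • w')
      = (9 : ℤ) • ((8 : ℤ) • ((3 : ℤ) • D₀ - w - (2 : ℤ) • w'))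
        - (8 : ℤ) • ((3 : ℤ) • ((8 : ℤ) • D₀ - (2 : ℤ) • w - (5 : ℤ) • w') - (2 : ℤ) • w - w') := by
  abel

end torsor

section cohomology

/-- `H¹(H; ℤ/24)` for `H = ⟨σ, τ⟩ = C₂ × C₂` acting on `ℤ/24` by `σ ↦ ×5`, `τ ↦ ×7`: a crossed homomorphism is a pair
`(u, v) = (c(σ), c(τ))` with `c(σ²) = (1+5)u = 0`, `c(τ²) = (1+7)v = 0`, `c(στ) = c(τσ)`: `u + 5v = v + 7u`.  There are 24.
[KLEIN-G46 §1.5]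
research route, not a corollary; conditional on HC_CM plus one named minimal statement. -/
theorem crossedHom_card :
    (Finset.univ.filter (fun uv : ZMod 24 × ZMod 24 =>
      6 * uv.1 = 0 ∧ 8 * uv.2 = 0 ∧ uv.1 + 5 * uv.2 = uv.2 + 7 * uv.1)).card = 24 := by
  decide

/-- The coboundaries `c(h) = (1 − h)·m`, i.e. `(u, v) = (−4m, −6m)`, `m ∈ ℤ/24`: there are 12; hence
`|H¹(H; ℤ/24)| = 24/12 = 2` — every admissible class carries exactly two `G`-structures.  [KLEIN-G46 §1.5]
research route, not a corollary; conditional on HC_CM plus one named minimal statement. -/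
theorem coboundary_card :
    (Finset.univ.image (fun m : ZMod 24 => ((-4 : ZMod 24) * m, (-6 : ZMod 24) * m))).card = 12 := by
  decide

/-- Coboundaries are crossed homomorphisms (sanity of the two counts above).  [KLEIN-G46 §1.5]
research route, not a corollary; conditional on HC_CM plus one named minimal statement. -/
theorem coboundary_subset_crossedHom :
    ∀ m : ZMod 24, 6 * ((-4 : ZMod 24) * m) = 0 ∧ 8 * ((-6 : ZMod 24) * m) = 0 ∧
      (-4 : ZMod 24) * m + 5 * ((-6 : ZMod 24) * m) = (-6 : ZMod 24) * m + 7 * ((-4 : ZMod 24) * m) := by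
  decide

/-- Lift obstruction for `α₅`: a lift `α̃₅ : z ↦ u z⁵` squares to `z ↦ ζ^k z` with `5k = k`; every such `k` is `(1+5)j`, so the
lift can be renormalised (`u ↦ ζ^j u`) to an involution.  [KLEIN-G46 §1.4]
research route, not a corollary; conditional on HC_CM plus one named minimal statement. -/
theorem lift_obstruction_five : ∀ k : ZMod 24, 5 * k = k → ∃ j : ZMod 24, k = 6 * j := by
  decide

/-- Lift obstruction for `α₁₁`: `11k = k` forces `k ∈ {0, 12} = (1+11)·ℤ/24`: no obstruction.  [KLEIN-G46 §1.4]
research route, not a corollary; conditional on HC_CM plus one named minimal statement. -/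
theorem lift_obstruction_eleven : ∀ k : ZMod 24, 11 * k = k → ∃ j : ZMod 24, k = 12 * j := by
  decide

/-- Lift obstruction for `α₇`: `7k = k` allows `k = 4`, which is NOT of the form `(1+7)j` — the obstruction group is `ℤ/2`
(a lift of `τ = α₇` may square to `x¹²`); it vanishes as soon as `τ` fixes a point of `C'` outside `B'`.  [KLEIN-G46 §1.4]
research route, not a corollary; conditional on HC_CM plus one named minimal statement. -/
theorem lift_obstruction_seven :
    (7 * (4 : ZMod 24) = 4 ∧ ∀ j : ZMod 24, (4 : ZMod 24) ≠ 8 * j) ∧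
      ∀ k : ZMod 24, 7 * k = k → ∃ j : ZMod 24, k = 8 * j ∨ k = 8 * j + 4 := by
  decide

/-- Involutions of `G = ℤ/24 ⋊ H` over `α₇`: `x^k α₇` is an involution iff `(1+7)k = 0` iff `3 ∣ k` (8 of them); conjugation
by `x^m` moves `k ↦ k − 6m` and by `α_b` moves `k ↦ bk`, so the two classes `s₇`, `x³s₇` are «`k ≡ 0`» and «`k ≡ 3 (mod 6)`»:
here the invariant `k ↦ 4k ∈ {0, 12}` separates them and is constant under both moves.  [KLEIN-G46 §1.4, §2.4]
research route, not a corollary; conditional on HC_CM plus one named minimal statement. -/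
theorem involutions_over_seven :
    (Finset.univ.filter (fun k : ZMod 24 => 8 * k = 0)).card = 8 ∧
      ∀ k : ZMod 24, 8 * k = 0 →
        ((4 * k = 0 ∨ 4 * k = 12) ∧ (∀ m : ZMod 24, 4 * (k - 6 * m) = 4 * k) ∧
          4 * (5 * k) = 4 * k ∧ 4 * (7 * k) = 4 * k ∧ 4 * (11 * k) = 4 * k) := by
  decide

/-- The `(2,1)`-point `x¹s₇`: `x^k α₇` with `3 ∤ k` has square `x^{8k} ∈ {x⁸, x¹⁶}` (order 6), and the two points `w, w'` of the
fibre (swapped by `α₅`, `k ↦ 5k`) carry the two residues `8` and `16`.  [KLEIN-G46 §1.1]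
research route, not a corollary; conditional on HC_CM plus one named minimal statement. -/
theorem order_six_over_seven_residues :
    ∀ k : ZMod 24, 8 * k ≠ 0 → ((8 * k = 8 ∨ 8 * k = 16) ∧ 8 * (5 * k) ≠ 8 * k ∧ 8 * (7 * k) = 8 * k) := by
  decide

/-- The centre of `G = ℤ/24 ⋊ {1,5,7,11}` meets `ℤ/24` in `{0, 12}` (`(a−1)k = 0` for `a = 5, 7, 11`), and no `x^k α_a`
(`a ≠ 1`) is central (`x^k α_a · x = x^{k+a} α_a ≠ x^{k+1} α_a = x · x^k α_a` as `a·1 ≠ 1`); so generating monodromy tuples have stabiliser of order 2 and the number of `G`-covers over a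
labelled configuration is (tuples with product one)/48.  [KLEIN-G46 §1.5]
research route, not a corollary; conditional on HC_CM plus one named minimal statement. -/
theorem centre_of_G :
    (∀ k : ZMod 24, (4 * k = 0 ∧ 6 * k = 0 ∧ 10 * k = 0) ↔ (k = 0 ∨ k = 12)) ∧
      ((5 : ZMod 24) * 1 ≠ 1 ∧ (7 : ZMod 24) * 1 ≠ 1 ∧ (11 : ZMod 24) * 1 ≠ 1) := by
  decide

end cohomology

section counts

/-- Model count for `a`: in `E_σ[8] ≅ (ℤ/8)²` the solutions of `4a = κ` (`κ` a fixed non-zero `2`-torsion point, here `(4,0)`)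
number `16 = |E_σ[4]|`.  [KLEIN-G46 §1.3]
research route, not a corollary; conditional on HC_CM plus one named minimal statement. -/
theorem model_count_a :
    (Finset.univ.filter (fun a : ZMod 8 × ZMod 8 => 4 * a.1 = 4 ∧ 4 * a.2 = 0)).card = 16 := by
  decide

/-- Model count for `c`: in `E_{στ}[8] ≅ (ℤ/8)²` the solutions of `4c = 0`, `2c = κ' = (4,0)` number `4 = |E_{στ}[2]|`.
[KLEIN-G46 §1.3]
research route, not a corollary; conditional on HC_CM plus one named minimal statement. -/
theorem model_count_c :
    (Finset.univ.filter (fun c : ZMod 8 × ZMod 8 =>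
      4 * c.1 = 0 ∧ 4 * c.2 = 0 ∧ 2 * c.1 = 4 ∧ 2 * c.2 = 0)).card = 4 := by
  decide

/-- Model count for `n`: in `E_τ ⊇ E_τ[3] ≅ (ℤ/3)²` the solutions of `3n = −w̄` form a torsor under `E_τ[3]`: 9 of them; in the
model, `3n = 0` has 9 solutions.  [KLEIN-G46 §1.2]
research route, not a corollary; conditional on HC_CM plus one named minimal statement. -/
theorem model_count_n :
    (Finset.univ.filter (fun n : ZMod 3 × ZMod 3 => 3 * n.1 = 0 ∧ 3 * n.2 = 0)).card = 9 := by
  decide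

/-- Cover-count arithmetic of KLEIN-G46 §1.5/§2: admissible classes per labelled configuration and the independent
monodromy-tuple counts.  Genus 3: `16·4·9/2 = 288 = 13824/48`; genus 4 (a): `3·16·16·9/4 = 1728 = 3·576`, `576 = 27648/48`,
the datum and its relabelling account for `2·576` and the third type for `576`; genus 4 (b): `3·256·4·9/4 = 6912 = 3·2304`,
`2304 = 110592/48`.  Dictionary: classes (both residue normalisations) `/ |H| · |H¹| =` covers: `2N/4·2 = N`.
research route, not a corollary; conditional on HC_CM plus one named minimal statement. -/
theorem cover_count_arithmetic :
    16 * 4 * 9 / 2 = 288 ∧ 13824 / 48 = 288 ∧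
    3 * 16 * 16 * 9 / 4 = 1728 ∧ 27648 / 48 = 576 ∧ 1728 = 2 * 576 + 576 ∧
    3 * 256 * 4 * 9 / 4 = 6912 ∧ 110592 / 48 = 2304 ∧ 6912 = 2 * 2304 + 2304 ∧
    (∀ N : ℕ, 2 * N / 4 * 2 = N ∨ N % 2 = 1) ∧ 530 + 2 + 3 = 535 := by
  refine ⟨by norm_num, by norm_num, by norm_num, by norm_num, by norm_num, by norm_num, by norm_num, by norm_num, ?_,
    by norm_num⟩
  intro N
  rcases Nat.even_or_odd N with ⟨k, hk⟩ | ⟨k, hk⟩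
  · left; omega
  · right; omega

end counts

section ellipticBase

/-!
### v2 append (same gen, KLEIN-G46 §9): the `f = 12` data over an elliptic base

`G₁₂ = ℤ/12 ⋊ ⟨τ⟩` with `τ x τ = x^h`, `h = 5` (`K = ℚ(i)`) or `h = 7` (`K = ℚ(√−3)`).  LEMMA A₁₂: the admissible classes are
`D₀ = w + φ_τ^*(e) + q` with (`h = 5`) `4e = d`, `q ∈ P[6]`, `q₃ ≠ 0` resp. (`h = 7`) `6e = 2d`, `q ∈ P[4] ∖ P[2]`, modulo `E_τ[2]`; the counts
below are the ones that the exact Riemann-existence enumeration over the elliptic base reproduces (5 120, 2 160, 186 368, 36 288).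
-/

/-- `H¹(⟨τ⟩; ℤ/12)` for `τ ↦ ×5`: crossed homomorphisms `v` with `(1+5)v = 0` (6 of them), coboundaries `(1−5)m` (3 of them): order 2.
[KLEIN-G46 §9.3]
research route, not a corollary; conditional on HC_CM plus one named minimal statement. -/
theorem crossedHom_card_twelve_five :
    (Finset.univ.filter (fun v : ZMod 12 => 6 * v = 0)).card = 6 ∧
      (Finset.univ.image (fun m : ZMod 12 => (-4 : ZMod 12) * m)).card = 3 := by
  decide

/-- `H¹(⟨τ⟩; ℤ/12)` for `τ ↦ ×7`: crossed homomorphisms `(1+7)v = 0` (4), coboundaries `(1−7)m` (2): order 2.  [KLEIN-G46 §9.3]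
research route, not a corollary; conditional on HC_CM plus one named minimal statement. -/
theorem crossedHom_card_twelve_seven :
    (Finset.univ.filter (fun v : ZMod 12 => 8 * v = 0)).card = 4 ∧
      (Finset.univ.image (fun m : ZMod 12 => (-6 : ZMod 12) * m)).card = 2 := by
  decide

/-- Centre of `G₁₂`: `x^k` is central iff `(h−1)k = 0`: `k ∈ {0,3,6,9}` for `h = 5` and `k ∈ 2ℤ/12` for `h = 7` — the stabiliser orders 4 and 6
by which the tuple counts of §9.3 are normalised (`24/4 = 6`, `24/6 = 4` conjugates per generating tuple).  [KLEIN-G46 §9.3]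
research route, not a corollary; conditional on HC_CM plus one named minimal statement. -/
theorem centre_twelve :
    (Finset.univ.filter (fun k : ZMod 12 => 4 * k = 0)).card = 4 ∧
      (Finset.univ.filter (fun k : ZMod 12 => 6 * k = 0)).card = 6 := by
  decide

/-- Residues at the marked pair for `f = 12`: the stabiliser `x^kτ` of a marked point has square `x^{(1+h)k}`; for `h = 5` the
non-involutions (`k` odd) all have square `x⁶` (residues `(6,6)`), for `h = 7` (`3 ∤ k`) the square is `x⁴` or `x⁸` (residues `{4,8}`).
[KLEIN-G46 §9.1]
research route, not a corollary; conditional on HC_CM plus one named minimal statement. -/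
theorem marked_residues_twelve :
    (∀ k : ZMod 12, 6 * k ≠ 0 → 6 * k = 6) ∧ (∀ k : ZMod 12, 8 * k ≠ 0 → (8 * k = 4 ∨ 8 * k = 8)) := by
  decide

/-- Model counts of LEMMA A₁₂ in `E_τ`: `4e = d` has `|E_τ[4]| = 16` solutions and `6e = 2d` has `|E_τ[6]| = 36` (torsors; in the model
`(ℤ/4)²` resp. `(ℤ/6)²` the homogeneous equations have 16 resp. 36 solutions).  [KLEIN-G46 §9.2]
research route, not a corollary; conditional on HC_CM plus one named minimal statement. -/
theorem model_count_e_twelve :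
    (Finset.univ.filter (fun e : ZMod 4 × ZMod 4 => 4 * e.1 = 0 ∧ 4 * e.2 = 0)).card = 16 ∧
      (Finset.univ.filter (fun e : ZMod 6 × ZMod 6 => 6 * e.1 = 0 ∧ 6 * e.2 = 0)).card = 36 := by
  decide

/-- The four admissible-class counts of LEMMA A₁₂ (`|P[m]| = m^{2·dim P}`, `dim P = g' − 1 = 2, 3`):
`h = 5`: `16·|P[2]|·(|P[3]| − 1)/4` = `16·16·80/4 = 5 120` (`g' = 3`), `16·64·728/4 = 186 368` (`g' = 4`);
`h = 7`: `36·(|P[4]| − |P[2]|)/4` = `36·240/4 = 2 160`, `36·4 032/4 = 36 288` — equal to the Riemann-existence counts of §9.3.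
research route, not a corollary; conditional on HC_CM plus one named minimal statement. -/
theorem admissible_counts_twelve :
    16 * 4 ^ 2 * (9 ^ 2 - 1) / 4 = 5120 ∧ 16 * 4 ^ 3 * (9 ^ 3 - 1) / 4 = 186368 ∧
      36 * (4 ^ 4 - 4 ^ 2) / 4 = 2160 ∧ 36 * (4 ^ 6 - 4 ^ 3) / 4 = 36288 ∧
        62123 + 62123 + 62122 = 186368 ∧ 2667 + 10 + 3 + 12 = 2692 ∧ 2699 - 2692 = 7 := by
  norm_num

end ellipticBase

end Summit.HodgeConjecture.Ring2AbelianAll.PrymTorelliKlein
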